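import Summits.KontsevichZagierPeriods.KontsevichZagierPeriods.Theorems.FermatIsogenyDeepWordSectorP07
/-! # `FermatIsogenyDeepWordSectorP08` — part 8/11 of the mechanical ≤400-line split of `DeepWordSector.lean` (sha256 5e8cd5c1c920648a…)
Source: decomp-kz lens-5 g22 DeepWordSector.lean v10 @5e8cd5c1 (the deep Beta-word sector node: bridge S ⟺ BetaWordTower ∧ WordSectorComplete, finite boxes, box ladder, shadow arithmetic, Chudnovsky levels; critic CLEARED g6-2/3/4/11/13/16/19); --supports stmt-KontsevichZagierPeriods-3898.
Split by census-1 g10 `gen/splitlean.py`: scopes re-opened with their `open`/`variable`/`set_option` context; mathematics and declaration order unchanged. -/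

namespace Summit.KontsevichZagierPeriods.FermatIsogeny.DeepTargets
open Literature.NumberTheory.Transcendental MeasureTheory
open Summit.KontsevichZagierPeriods.KontsevichZagierPeriods.Theses.FermatIsogeny (BetaLinearSector BetaProductSector FermatSectorComplete)

open Literature.NumberTheory.Transcendental MeasureTheory in
open Summit.KontsevichZagierPeriods.KontsevichZagierPeriods.Theses.FermatIsogeny (BetaLinearSector BetaProductSector FermatSectorComplete) in
/-- Rational numbers are real algebraic. [bookkeeping] -/
private theorem isAlgebraic_ratCast (x : ℚ) : IsAlgebraic ℚ (x : ℝ) := by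
  have h := isAlgebraic_algebraMap (R := ℚ) (A := ℝ) x
  rwa [eq_ratCast] at h

/-- **Under the shadow the box IS its chain part**: `BoxTranscendence k N T → (BetaWordSectorLevel k N ↔ BoxChain k N T)`. [this node] -/
theorem box_iff_boxChain {k N : ℕ} (hN : 0 < N) {T : PatternPred k N} (hT : BoxTranscendence k N T) :
    BetaWordSectorLevel k N ↔ BoxChain k N T :=
  ⟨boxChain_of_box T, fun hC => box_of_chain_of_transcendence hN hC hT⟩

/-- **The exact split** `Box ↔ Chain_T ∧ Chain_{¬T}` (no hypothesis). [this node] -/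
theorem box_iff_boxChain_and_coChain {k N : ℕ} (T : PatternPred k N) :
    BetaWordSectorLevel k N ↔ BoxChain k N T ∧ BoxChain k N (fun u v u' v' => ¬ T u v u' v') := by
  refine ⟨fun h => ⟨boxChain_of_box T h, boxChain_of_box _ h⟩, fun h u v u' v' => ?_⟩
  by_cases ht : T u v u' v'
  · exact h.1 u v u' v' ht
  · exact h.2 u v u' v' ht

/-- **The shadow makes the co-chain vacuous.** [this node] -/
theorem coChain_of_transcendence {k N : ℕ} (hN : 0 < N) {T : PatternPred k N} (hT : BoxTranscendence k N T) :
    BoxChain k N (fun u v u' v' => ¬ T u v u' v') := by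
  intro u v u' v' ht q hq r r' hr hi hr' hi' hv
  exact False.elim (hT u v u' v' ht
    (by rw [← eq_ratio_of_value_eq hN u v u' v' q hq r r' hr hi hr' hi' hv]; exact hq))

/-- Monotonicity of the shadow in the predicate. [bookkeeping] -/
theorem boxTranscendence_mono {k N : ℕ} {T T' : PatternPred k N} (hTT' : ∀ u v u' v', T u v u' v' → T' u v u' v')
    (hT : BoxTranscendence k N T) : BoxTranscendence k N T' :=
  fun u v u' v' h => hT u v u' v' fun ht => h (hTT' u v u' v' ht)

/-! ### Rung `(k, 2)`: every level-2 box holds (chains on equal π-count, Lindemann off it) -/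

/-- Auxiliary step `isAlgebraic_two`: is Algebraic two. [bookkeeping] -/
private theorem isAlgebraic_two : IsAlgebraic ℚ (2:ℝ) := by
  simpa using isAlgebraic_ratCast 2

/-- `β(1,1) = 1` in `P`. [folklore] -/
theorem bcl_one_one : bcl 1 1 = 1 := by
  rw [bcl_rat_one 1 one_pos, ← kc_one]
  exact kc_congr _ _ (by norm_num)

/-- `β(½,1) = κ(2)` in `P`. [folklore] -/
theorem bcl_half_one : bcl (1/2) 1 = kc 2 isAlgebraic_two := by
  rw [bcl_rat_one (1/2) (by norm_num)]
  exact kc_congr _ _ (by norm_num)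

/-- `β(1,½) = κ(2)` in `P` (reflection). [folklore] -/
theorem bcl_one_half : bcl 1 (1/2) = kc 2 isAlgebraic_two := by
  rw [bcl_symm betaReflectionMove_holds 1 (1/2) one_pos (by norm_num), bcl_half_one]

/-- `κ(a)^n = κ(a^n)`. [folklore] -/
theorem kc_pow (a : ℝ) (ha : IsAlgebraic ℚ a) (n : ℕ) : kc a ha ^ n = kc (a ^ n) (ha.pow n) := by
  induction n with
  | zero => rw [pow_zero, ← kc_one]; exact kc_congr _ _ (pow_zero a).symm
  | succ n ih => rw [pow_succ, ih, ← kc_mul]; exact kc_congr _ _ (pow_succ a n).symm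

/-- Exponent of the π-letter: `1` if the level-2 letter `(x,y)` is `β(½,½)`, else `0`. [bookkeeping] -/
def piExp (x y : Fin 2) : ℕ := if x = 0 ∧ y = 0 then 1 else 0

/-- Exponent of `κ(2)`: `1` if exactly one exponent of the level-2 letter is `½` (`β(½,1) = β(1,½) = κ(2)`), else `0`. [bookkeeping] -/
def twoExp (x y : Fin 2) : ℕ := if (x = 0 ∧ ¬ y = 0) ∨ (¬ x = 0 ∧ y = 0) then 1 else 0

/-- Number of π-letters `β(½,½)` of the level-2 word `(u,v)`. [bookkeeping] -/
def piCount {k : ℕ} (u v : Fin k → Fin 2) : ℕ := ∑ i, piExp (u i) (v i)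

/-- Number of `κ(2)`-letters of the level-2 word `(u,v)`. [bookkeeping] -/
def twoCount {k : ℕ} (u v : Fin k → Fin 2) : ℕ := ∑ i, twoExp (u i) (v i)

/-- The chain predicate at level 2: the two words have the same number of π-letters. [this node] -/
def EqPiCount {k : ℕ} : PatternPred k 2 := fun u v u' v' => piCount u v = piCount u' v'

/-- Auxiliary step `lvl_two`: lvl two. [bookkeeping] -/
theorem lvl_two {k : ℕ} (w : Fin k → Fin 2) (i : Fin k) : lvl 2 w i = if w i = 0 then 1/2 else 1 := by
  unfold lvl
  split_ifs with h
  · rw [h]; norm_num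
  · have hlt := (w i).isLt
    have h0 : (w i : ℕ) ≠ 0 := fun e => h (Fin.ext e)
    have h1 : (w i : ℕ) = 1 := by omega
    rw [show ((w i : ℕ) : ℚ) = 1 by exact_mod_cast h1]
    norm_num

/-- **The level-2 letters in `P`**: `β((x+1)/2,(y+1)/2) = β(½,½)^{[x=y=0]} · κ(2)^{[exactly one of x,y is 0]}`. [this node] -/
theorem letter_two {k : ℕ} (u v : Fin k → Fin 2) (i : Fin k) :
    bcl (lvl 2 u i) (lvl 2 v i) = bcl (1/2) (1/2) ^ piExp (u i) (v i) * kc 2 isAlgebraic_two ^ twoExp (u i) (v i) := by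
  rw [lvl_two u i, lvl_two v i]
  by_cases h1 : u i = 0
  · by_cases h2 : v i = 0
    · rw [if_pos h1, if_pos h2]
      simp [piExp, twoExp, h1, h2]
    · rw [if_pos h1, if_neg h2, bcl_half_one]
      simp [piExp, twoExp, h1, h2]
  · by_cases h2 : v i = 0
    · rw [if_neg h1, if_pos h2, bcl_one_half]
      simp [piExp, twoExp, h1, h2]
    · rw [if_neg h1, if_neg h2, bcl_one_one]
      simp [piExp, twoExp, h1, h2]

/-- **A level-2 word in `P`**: `∏ᵢ β((uᵢ+1)/2,(vᵢ+1)/2) = β(½,½)^{#π-letters} · κ(2)^{#κ(2)-letters}`. [this node] -/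
theorem word_class_two {k : ℕ} (u v : Fin k → Fin 2) :
    ∏ i, bcl (lvl 2 u i) (lvl 2 v i) = bcl (1/2) (1/2) ^ piCount u v * kc 2 isAlgebraic_two ^ twoCount u v := by
  simp_rw [letter_two u v]
  rw [Finset.prod_mul_distrib, Finset.prod_pow_eq_pow_sum, Finset.prod_pow_eq_pow_sum]
  rfl

/-- **Values of level-2 words**: `∏ᵢ B((uᵢ+1)/2,(vᵢ+1)/2) = π^{#π-letters} · 2^{#κ(2)-letters}`. [this node] -/
theorem prod_bval_two {k : ℕ} (u v : Fin k → Fin 2) :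
    ∏ i, bval (lvl 2 u i) (lvl 2 v i) = Real.pi ^ piCount u v * 2 ^ twoCount u v := by
  have h := congrArg KZ.evalP (word_class_two u v)
  rw [map_prod, map_mul, map_pow, map_pow, evalP_kc] at h
  rw [← bval_half_half]
  exact h

/-- Auxiliary step `ratio_two`: ratio two. [bookkeeping] -/
theorem ratio_two {k : ℕ} (u v u' v' : Fin k → Fin 2) :
    ratio u v u' v' = Real.pi ^ piCount u v * 2 ^ twoCount u v / (Real.pi ^ piCount u' v' * 2 ^ twoCount u' v') := by
  rw [ratio, prod_bval_two, prod_bval_two]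

/-- **Lindemann decides the level-2 shadow**: `π^j 2^t/(π^{j'} 2^{t'}) ∈ ℚ̄ ⇒ j = j'` (tree theorem `transcendental_pi_holds`).
(cite Lindemann1882) -/
theorem piCount_eq_of_isAlgebraic {j j' t t' : ℕ}
    (h : IsAlgebraic ℚ (Real.pi ^ j * 2 ^ t / (Real.pi ^ j' * 2 ^ t'))) : j = j' := by
  have hπ : Transcendental ℚ Real.pi := transcendental_pi_holds
  have hπ0 : Real.pi ≠ 0 := Real.pi_ne_zero
  have h2t : IsAlgebraic ℚ ((2:ℝ) ^ t' / 2 ^ t) := by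
    rw [show ((2:ℝ) ^ t' / 2 ^ t) = (((2:ℚ) ^ t' / 2 ^ t : ℚ) : ℝ) by push_cast; rfl]
    exact isAlgebraic_ratCast _
  have hq : IsAlgebraic ℚ (Real.pi ^ j / Real.pi ^ j') := by
    have hm := h.mul h2t
    have e : Real.pi ^ j * 2 ^ t / (Real.pi ^ j' * 2 ^ t') * (2 ^ t' / 2 ^ t) = Real.pi ^ j / Real.pi ^ j' := by
      field_simp
    rwa [e] at hm
  rcases Nat.le_total j' j with hle | hle
  · have e : Real.pi ^ j / Real.pi ^ j' = Real.pi ^ (j - j') := (pow_sub₀ _ hπ0 hle).symm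
    rw [e] at hq
    by_contra hne
    exact hπ.pow (Nat.sub_pos_of_lt (lt_of_le_of_ne hle (Ne.symm hne))) hq
  · have e : Real.pi ^ j / Real.pi ^ j' = (Real.pi ^ (j' - j))⁻¹ := by
      rw [pow_sub₀ _ hπ0 hle, mul_inv, inv_inv, mul_comm, ← div_eq_mul_inv]
    rw [e] at hq
    by_contra hne
    exact hπ.pow (Nat.sub_pos_of_lt (lt_of_le_of_ne hle hne)) (by simpa using hq.inv)

/-- **The shadow at level 2 holds for every `k`** (Lindemann). [this node] -/
theorem boxTranscendence_two (k : ℕ) : BoxTranscendence k 2 EqPiCount := by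
  intro u v u' v' hT halg
  rw [ratio_two] at halg
  exact hT (piCount_eq_of_isAlgebraic halg)

/-- **The chain part at level 2 holds for every `k`**: on equal π-count the value hypothesis forces `q = 2^{t−t'}` and both classes
are `β(½,½)^j κ(2)^t` in `P`. [this node] -/
theorem boxChain_two (k : ℕ) : BoxChain k 2 EqPiCount := by
  intro u v u' v' hT q hq r r' hr hi hr' hi' hv
  have hab : ∀ j, 0 < lvl 2 u j ∧ 0 < lvl 2 v j := fun j => ⟨(lvl_bounds two_pos u j).1, (lvl_bounds two_pos v j).1⟩
  have hab' : ∀ j, 0 < lvl 2 u' j ∧ 0 < lvl 2 v' j := fun j => ⟨(lvl_bounds two_pos u' j).1, (lvl_bounds two_pos v' j).1⟩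
  have hj : piCount u v = piCount u' v' := hT
  have er : KZ.toFormalPeriod (KZ.of r) = bcl (1/2) (1/2) ^ piCount u' v' * kc 2 isAlgebraic_two ^ twoCount u v := by
    rw [word_class _ _ hab r hr hi, word_class_two, hj]
  have er' : KZ.toFormalPeriod (KZ.of r') =
      kc q hq * (bcl (1/2) (1/2) ^ piCount u' v' * kc 2 isAlgebraic_two ^ twoCount u' v') := by
    rw [word_class_const q hq _ _ hab' r' hr' hi', word_class_two]
  have hπ0 : Real.pi ≠ 0 := Real.pi_ne_zero
  have hq2 : q * 2 ^ twoCount u' v' = 2 ^ twoCount u v := by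
    have e := eq_ratio_of_value_eq two_pos u v u' v' q hq r r' hr hi hr' hi' hv
    rw [ratio_two, hj, mul_div_mul_left _ _ (pow_ne_zero _ hπ0)] at e
    rw [e, div_mul_cancel₀ _ (pow_ne_zero _ two_ne_zero)]
  have e : KZ.toFormalPeriod (KZ.of r) = KZ.toFormalPeriod (KZ.of r') := by
    rw [er, er', mul_left_comm]
    simp only [kc_pow]
    rw [← kc_mul, kc_congr (hq.mul (isAlgebraic_two.pow _)) (isAlgebraic_two.pow _) hq2]
  show KZ.of r - KZ.of r' ∈ KZ.relations
  exact KZ.toFormalPeriod_eq_iff.mp e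

/-- **RUNG `(k,2)`: every level-2 box holds**, unconditionally. [this node] -/
theorem betaWordSectorLevel_two (k : ℕ) : BetaWordSectorLevel k 2 :=
  box_of_chain_of_transcendence two_pos (boxChain_two k) (boxTranscendence_two k)

/-- Hence the open content of `BetaWordSector k` (so of cruxes 3897, 3898) starts at level 3:
`BetaWordSector k ↔ ∀ N ≥ 3, BetaWordSectorLevel k N`. [this node] -/
theorem betaWordSector_iff_levels_three_le (k : ℕ) : BetaWordSector k ↔ ∀ N, 3 ≤ N → BetaWordSectorLevel k N := by
  rw [betaWordSector_iff_levels_two_le]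
  refine ⟨fun h N hN => h N (by omega), fun h N hN => ?_⟩
  rcases Nat.lt_or_ge N 3 with hlt | hge
  · obtain rfl : N = 2 := by omega
    exact betaWordSectorLevel_two k
  · exact h N hge

/-- Auxiliary step `betaProductSector_iff_levels_three_le`: beta Product Sector iff levels three le. [bookkeeping] -/
theorem betaProductSector_iff_levels_three_le : BetaProductSector ↔ ∀ N, 3 ≤ N → BetaWordSectorLevel 2 N :=
  betaWordSector_two_iff.symm.trans (betaWordSector_iff_levels_three_le 2)

/-- Auxiliary step `betaLinearSector_iff_levels_three_le`: beta Linear Sector iff levels three le. [bookkeeping] -/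
theorem betaLinearSector_iff_levels_three_le : BetaLinearSector ↔ ∀ N, 3 ≤ N → BetaWordSectorLevel 1 N :=
  betaWordSector_one_iff.symm.trans (betaWordSector_iff_levels_three_le 1)

/-! ### The natural predicate: Deligne–Koblitz–Ogus type `0` of the Γ-ratio; the Wolfart–Wüstholz / Rohrlich–Lang shadows -/

/-- Γ-multiplicities on the numerators `i ∈ [1,N)` contributed by the letter `β((x+1)/N,(y+1)/N)`: `B(a,b) = Γ(a)Γ(b)/Γ(a+b)`
gives `+1` at the residues of `x+1`, `y+1` and `−1` at the residue of `x+y+2`; integral arguments (residue `0`) drop out because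
`IsHodgeTypeGammaMonomial` sums over `i ∈ [1,N)`, and `Γ((x+y+2)/N)` with `x+y+2 > N` differs from `Γ` of the residue by a
rational factor. (cite Waldschmidt2006, §2.2) -/
def letterMult (N : ℕ) (x y : Fin N) (i : ℕ) : ℤ :=
  (if ((x:ℕ) + 1) % N = i then 1 else 0) + (if ((y:ℕ) + 1) % N = i then 1 else 0)
    - (if ((x:ℕ) + (y:ℕ) + 2) % N = i then 1 else 0)

/-- The Γ-monomial exponent vector of the value ratio of two level-`N` words. [this node] -/
def pairMult {k : ℕ} (N : ℕ) (u v u' v' : Fin k → Fin N) (i : ℕ) : ℤ :=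
  (∑ j, letterMult N (u j) (v j) i) - ∑ j, letterMult N (u' j) (v' j) i

/-- **DKO type 0**: the Γ-monomial `ρ(u,v;u',v')·(rational)` has Deligne–Koblitz–Ogus Hodge type identically `0`
(`IsHodgeTypeGammaMonomial N · 0`), the known sufficient — and conjecturally (Rohrlich–Lang) necessary — condition for `ρ ∈ ℚ̄`.
(cite Waldschmidt2006, §2.2) -/
def SameType {k : ℕ} (N : ℕ) : PatternPred k N := fun u v u' v' => IsHodgeTypeGammaMonomial N (pairMult N u v u' v') 0

/-- **Wolfart–Wüstholz (1985) for pairs of Beta values at rational points** (typed hypothesis = the printed theorem as quoted in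
(cite Waldschmidt2006, p.441): the only `ℚ̄`-linear relations `B(a,b) = q·B(a',b')` between Beta values at rational points are
the Deligne–Koblitz–Ogus ones): if `B((x+1)/N,(y+1)/N)/B((x'+1)/N,(y'+1)/N) ∈ ℚ̄` then the Γ-ratio has DKO type `0`.
Proved in print via Wüstholz's analytic subgroup theorem on the Fermat Jacobian; NOT in the tree. -/
def WolfartWustholzPairs : Prop :=
  ∀ N : ℕ, 0 < N → ∀ x y x' y' : Fin N,
    IsAlgebraic ℚ (bval (((x:ℕ) + 1 : ℚ) / N) (((y:ℕ) + 1 : ℚ) / N) / bval (((x':ℕ) + 1 : ℚ) / N) (((y':ℕ) + 1 : ℚ) / N)) →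
      IsHodgeTypeGammaMonomial N (fun i => letterMult N x y i - letterMult N x' y' i) 0

/-- **Rohrlich(–Lang) shadow for words of length `k`**: at every level, a pattern whose value ratio is algebraic has DKO type `0`
(the `T = SameType` transcendence shadow of every `(k,N)` box).  The value ratio is `q · ∏_{i<N} Γ(i/N)^{pairMult i}`, `q ∈ ℚˣ`,
so this is implied by ROHRLICH'S CONJECTURE («every multiplicative relation `π^{b/2} ∏ Γ(a)^{m_a} ∈ ℚ̄` follows from the standard
relations», (cite Waldschmidt2006, Conjecture 21)) together with Deligne–Koblitz–Ogus and Lindemann; a fortiori by Rohrlich–Lang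
((cite Waldschmidt2006, Conjecture 22)).  KNOWN CASES: `k = 1`, every `N`: Wolfart–Wüstholz 1985 (`rohrlichLangShadow_one_of_WW`);
`N = 2`, every `k`: Lindemann (`boxTranscendence_two_sameType`, PROVED below); `N ∈ {3,4,6}`: Chudnovsky 1976 (`π ⟂ Γ(1/3)`, `π ⟂ Γ(1/4)`,
(cite Waldschmidt2006, Theorem 14); not formalised).  OPEN for `k ≥ 2` at `N = 5` and every `N ≥ 7` (e.g. `B(⅕,⅕)²/(B(⅕,⅖)B(⅕,⅘)) ∈
ℚ̄ˣ·Γ(⅕)³Γ(⅖)⁻⁴`; instrument `shadow_census.py`: 99072 of the 390625 ordered patterns of box `(2,5)` are of this open kind). -/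
def RohrlichLangShadow (k : ℕ) : Prop := ∀ N : ℕ, 0 < N → BoxTranscendence k N (SameType N)

/-- Auxiliary step `pairMult_one`: pair Mult one. [bookkeeping] -/
theorem pairMult_one {N : ℕ} (u v u' v' : Fin 1 → Fin N) :
    pairMult N u v u' v' = fun i => letterMult N (u 0) (v 0) i - letterMult N (u' 0) (v' 0) i := by
  funext i
  simp [pairMult]

/-- Auxiliary step `ratio_one`: ratio one. [bookkeeping] -/
theorem ratio_one {N : ℕ} (u v u' v' : Fin 1 → Fin N) :
    ratio u v u' v' = bval ((((u 0 : ℕ)) + 1 : ℚ) / N) ((((v 0 : ℕ)) + 1 : ℚ) / N)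
      / bval ((((u' 0 : ℕ)) + 1 : ℚ) / N) ((((v' 0 : ℕ)) + 1 : ℚ) / N) := by
  simp [ratio, lvl]

/-- **`k = 1`: the Wolfart–Wüstholz theorem IS the Rohrlich–Lang shadow of the one-letter boxes.** [this node] -/
theorem rohrlichLangShadow_one_of_WW (hWW : WolfartWustholzPairs) : RohrlichLangShadow 1 := by
  intro N hN u v u' v' hT halg
  apply hT
  show IsHodgeTypeGammaMonomial N (pairMult N u v u' v') 0
  rw [pairMult_one]
  rw [ratio_one] at halg
  exact hWW N hN (u 0) (v 0) (u' 0) (v' 0) halg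

/-- **Crux 3897 has no transcendence residue beyond Wolfart–Wüstholz**:
`WolfartWustholzPairs → (BetaLinearSector ↔ ∀ N > 0, BoxChain 1 N (SameType N))` — given the 1985 theorem, 3897 is EXACTLY the family
of finite chain statements «same DKO type ⇒ KZ-equivalent» for single letters. [this node] -/
theorem betaLinearSector_iff_sameTypeChains (hWW : WolfartWustholzPairs) :
    BetaLinearSector ↔ ∀ N, 0 < N → BoxChain 1 N (SameType N) := by
  rw [betaLinearSector_iff_levels']
  exact forall₂_congr fun N hN => box_iff_boxChain hN (rohrlichLangShadow_one_of_WW hWW N hN)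

/-- **The general factorisation**: `RohrlichLangShadow k → (BetaWordSector k ↔ ∀ N > 0, BoxChain k N (SameType N))`. [this node] -/
theorem betaWordSector_iff_sameTypeChains {k : ℕ} (hRL : RohrlichLangShadow k) :
    BetaWordSector k ↔ ∀ N, 0 < N → BoxChain k N (SameType N) := by
  rw [betaWordSector_iff_levels']
  exact forall₂_congr fun N hN => box_iff_boxChain hN (hRL N hN)

/-- **Crux 3898 factors through the Rohrlich–Lang shadow for letter pairs**:
`RohrlichLangShadow 2 → (BetaProductSector ↔ ∀ N > 0, BoxChain 2 N (SameType N))`. [this node] -/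
theorem betaProductSector_iff_sameTypeChains (hRL : RohrlichLangShadow 2) :
    BetaProductSector ↔ ∀ N, 0 < N → BoxChain 2 N (SameType N) := by
  rw [betaProductSector_iff_levels']
  exact forall₂_congr fun N hN => box_iff_boxChain hN (hRL N hN)

/-- Unconditionally, the sector IMPLIES all its DKO-chains (the converse is where the shadow enters). [bookkeeping] -/
theorem sameTypeChains_of_betaWordSector {k : ℕ} (h : BetaWordSector k) : ∀ N, 0 < N → BoxChain k N (SameType N) :=
  fun N hN => boxChain_of_box _ ((betaWordSector_iff_levels' k).1 h N hN)

/-! ### At level 2 the DKO predicate is the π-count and the Rohrlich–Lang shadow is Lindemann -/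

/-- Auxiliary step `letterMult_two_one`: letter Mult two one. [bookkeeping] -/
theorem letterMult_two_one (x y : Fin 2) : letterMult 2 x y 1 = 2 * (piExp x y : ℤ) := by
  fin_cases x <;> fin_cases y <;> decide

/-- Auxiliary step `pairMult_two_one`: pair Mult two one. [bookkeeping] -/
theorem pairMult_two_one {k : ℕ} (u v u' v' : Fin k → Fin 2) :
    pairMult 2 u v u' v' 1 = 2 * (piCount u v : ℤ) - 2 * (piCount u' v' : ℤ) := by
  simp only [pairMult, letterMult_two_one, piCount, Nat.cast_sum, Finset.mul_sum]

/-- At `d = 2` a Γ-monomial has Hodge type `0` iff the exponent of `Γ(½)` vanishes. [folklore] -/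
theorem isHodgeTypeGammaMonomial_two_zero_iff (n : ℕ → ℤ) : IsHodgeTypeGammaMonomial 2 n 0 ↔ n 1 = 0 := by
  have hIco : Finset.Ico 1 2 = {1} := by decide
  have hfr : Int.fract ((1:ℚ) / 2) = 1/2 := by
    rw [Int.fract_eq_iff]
    exact ⟨by norm_num, by norm_num, 0, by norm_num⟩
  unfold IsHodgeTypeGammaMonomial
  constructor
  · intro h
    have h1 := h 1 (Nat.coprime_one_left 2)
    rw [hIco, Finset.sum_singleton] at h1
    have h1' : (n 1 : ℚ) * (1/2) = 0 := by
      have e : Int.fract (((1:ℕ):ℚ) * ((1:ℕ):ℚ) / ((2:ℕ):ℚ)) = 1/2 := by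
        rw [← hfr]; norm_num
      rw [e] at h1
      exact_mod_cast h1
    have : (n 1 : ℚ) = 0 := by linarith
    exact_mod_cast this
  · intro h u _
    rw [hIco, Finset.sum_singleton, h]
    simp

/-- **At level 2, DKO type 0 = equal π-count.** [this node] -/
theorem sameType_two_iff {k : ℕ} (u v u' v' : Fin k → Fin 2) : SameType 2 u v u' v' ↔ EqPiCount u v u' v' := by
  show IsHodgeTypeGammaMonomial 2 (pairMult 2 u v u' v') 0 ↔ piCount u v = piCount u' v'
  rw [isHodgeTypeGammaMonomial_two_zero_iff, pairMult_two_one]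
  omega

/-- **The Rohrlich–Lang shadow at level 2 is a theorem (Lindemann), for every word length `k`.** [this node] -/
theorem boxTranscendence_two_sameType (k : ℕ) : BoxTranscendence k 2 (SameType 2) :=
  fun u v u' v' hT => boxTranscendence_two k u v u' v' fun h => hT ((sameType_two_iff u v u' v').2 h)

/-- … and the DKO-chain part at level 2 holds. [this node] -/
theorem boxChain_two_sameType (k : ℕ) : BoxChain k 2 (SameType 2) :=
  boxChain_of_box _ (betaWordSectorLevel_two k)

/-! ## v8 (lens-5 g22 · addendum 1) — THE SHADOW IS Γ-ARITHMETIC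

Word ratios are Γ-monomials on the generators `Γ(m/N)`, `0 < m < N`, up to a positive rational
(`ratio_eq_rat_mul_monomial`: the integer arguments `Γ(1) = Γ(2) = 1` drop out and `Γ(1 + m/N) = (m/N)·Γ(m/N)`).
Consequences, all sorry-free:
* the **Koblitz–Ogus direction** from the tree (Deligne, `deligne_gammaMonomial_algebraic_holds`): same DKO type ⇒
  the value ratio is algebraic (`isAlgebraic_ratio_of_sameType`) — so on the chain side the value hypothesis of a
  box is always satisfiable with `q := ratio`;
* the **constant-type shadow at EVERY level, PROVED** from two tree theorems (Deligne + Lindemann): a pattern of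
  constant non-zero DKO type has transcendental ratio (`transcendental_ratio_of_constType`), whence
  `boxTranscendence_notConstType : BoxTranscendence k N (NotConstType N)` and the unconditional
  `box_iff_boxChain_notConstType : BetaWordSectorLevel k N ↔ BoxChain k N (NotConstType N)` (`1 < N`):
  every finite box minus its Lindemann part — at `N = 2` this is the whole shadow (rung (k,2) again);
* the whole Rohrlich shadow from ONE typed Γ-statement `RohrlichHodge` («an algebraic Γ-monomial on `Γ(m/N)` has
  DKO type identically 0» — the Hodge-type form of Rohrlich's Conjecture 21 tensored with `ℚ`; OPEN, a conjecture,
  typed here as a hypothesis and never as a fact): `rohrlichLangShadow_of_rohrlichHodge : RohrlichHodge → ∀ k,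
  RohrlichLangShadow k`, hence `betaWordSector_iff_sameTypeChains_of_rohrlichHodge`.
-/

end Summit.KontsevichZagierPeriods.FermatIsogeny.DeepTargets
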